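import Summits.QuantumFields.YangMills.Theorems.SwapVirialDeficitSectorLaplaceTipLeaderLayerMerge
import Summits.QuantumFields.YangMills.Theorems.SwapVirialDeficitSectorLaplaceTipOrigLayer
import Summits.QuantumFields.YangMills.Theorems.SwapVirialDeficitSectorLaplaceTipCoreAssemblyMeas
import HarnessLib

/-!
# THE LEADER-LAYER INSTANCE: `regionSocket PX ∧ regionSocket PY ⟹ hLLm ⟹ (hCore)` with ORIG discharged by LEAD's ✓`leaderLayer_ORIG`
# (cell ym-idea-1, skeleton ➎, `stub_core_tip`; LEAD g100 ruling 2026-09-01T03:01Z (a); seat ym-line-fcl-p3 g49 as ➎ assembler, free-hands support of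
# ⟨stmt-QuantumFields-24197⟩ `SwapVirialDeficit.SwapGluedStiffness`)

SOCKETS FIRST, composition only (no model content):
* `tip_leaderLayer (hX : regionSocket PX) (hY : regionSocket PY) : hLLm` :=
  ✓`leaderLayer_aligned ORIG PX PY` ✓`leaderRegions_cover` ✓`leaderLayer_ORIG` `hX` `hY` (regions EXACTLY as in ✓`leaderRegions_cover`:
  `ORIG = {|x|² ≤ (1+δt²)⁻¹ ∧ |y|² ≤ (1+δt²)⁻¹}`, `PX = {|y|² ≤ |x|² ∧ (1+δt²)⁻¹ < |x|²}`, `PY = {|x|² < |y|² ∧ (1+δt²)⁻¹ < |y|²}`, squared letters `normSq3`);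
* `hubIntegral_hubAt_core_ceiling_of_PX_PY (hX) (hY) : <the frozen (hCore) binder VERBATIM>` := ✓`hubIntegral_hubAt_core_ceiling_of_leaderLayer_meas (tip_leaderLayer hX hY)`.
Downstream (by name): ✓`stub_core_tip_of_core (hubIntegral_hubAt_core_ceiling_of_PX_PY hX hY) : stub_core_tip` (✓`…TipGlue`), i.e. skeleton ➎ is now
`regionSocket PX ∧ regionSocket PY` (w2 g61 F5 `leaderLayer_PX`, then PY).

HONEST LABEL: composition only; PX ∕ PY region sockets OPEN ⟹ hLLm ∕ (hCore) ∕ `stub_core_tip` ∕ ⟨24197⟩ ∕ ⟨24194⟩ OPEN; item of record ⟨24085⟩ aside ∕ untouched;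
the Yang–Mills mass gap is NOT proved; no summit is proved by a line.  THEOREMS ONLY (0 `def`, 0 `sorry`, no instance, no notation), standard axioms.
`--supports stmt-QuantumFields-24197`.  References: [cite: Luscher1983, §2]; [folklore].
-/

set_option autoImplicit false
set_option synthInstance.maxSize 1024

noncomputable section

open MeasureTheory Quaternion Set Module
open scoped Quaternion BigOperators ENNReal InnerProductSpace
open Literature.MathematicalPhysics.QuantumLattice
open Literature.MathematicalPhysics.QuantumFieldTheory hiding SU2

namespace Summit.QuantumFields.YangMills.Theorems.SwapVirialDeficit.SectorLaplace

open Summit.QuantumFields.YangMills.Theorems.FemtoTransferGap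
open Summit.QuantumFields.YangMills.Theorems.FemtoTransferGap.TT
open Summit.QuantumFields.YangMills.Theorems.VirialFluxGap.RingDeficit
open Summit.QuantumFields.YangMills.Theorems.SwapVirialDeficit.SwapRing
open Summit.QuantumFields.YangMills.Theorems.SwapVirialDeficit.BlowUpRing
open Summit.QuantumFields.YangMills.Theorems.SwapVirialDeficit.Gnomonic (piWeight gnomonicWeight normSq3)

/-- ★★ The leader-layer instance: the PX ∕ PY region sockets give `hLLm` (ORIG by ✓`leaderLayer_ORIG`, merge by ✓`leaderLayer_aligned`). [cite: Luscher1983, §2] -/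
theorem tip_leaderLayer
    (hX : (∃ Φ : ℝ, 0 < Φ ∧ ∃ cΦ : ℕ, ∃ CT : ℝ, ∃ pT : ℕ, ∃ QT : ℝ, 0 < QT ∧ ∃ K₁ : ℝ, 0 < K₁ ∧ ∃ k₁ : ℕ, ∃ DR : ℝ, 1 ≤ DR ∧ ∃ dR : ℕ,
      ∀ (L : ℕ) [NeZero L] (b : ℝ), K₁ * (L : ℝ) ^ k₁ ≤ b → ∀ ε : GnoSign L, GoodSign ε → ∀ δt : ℝ, DR * (L : ℝ) ^ dR ≤ δt →
        ∀ (A0 : GnoCoord L → GnoFol L →ₗ[ℝ] GnoFol L), (∀ η, (A0 η).IsSymmetric) →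
          (∀ η (y : GnoFol L), ⟪A0 η y, y⟫_ℝ = iteratedFDeriv ℝ 2 (fun y' : GnoFol L => gnoDeficit z₀ (fun _ => 1) ((1 : ℝ) : ℍ) ε (η + gnoFolEmb y')) 0 (fun _ => y)) →
          (∀ η (y : GnoFol L), ⟪A0 η y, y⟫_ℝ = iteratedDeriv 2 (fun s : ℝ => gnoDeficit (fun _ => false) (fun _ => 1) ((1 : ℝ) : ℍ) ε (η + s • gnoFolEmb y)) 0) →
          (∀ η (y : GnoFol L), ⟪A0 η y, y⟫_ℝ = iteratedFDeriv ℝ 2 (gnoDeficit z₀ (fun _ => 1) ((1 : ℝ) : ℍ) ε) η (fun _ => gnoFolEmb y)) →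
          (Measurable fun q : GnoCoord L × GnoFol L => ⟪A0 q.1 q.2, q.2⟫_ℝ) →
          ∫⁻ xy in {xy : (Fin 3 → ℝ) × (Fin 3 → ℝ) | normSq3 xy.2 ≤ normSq3 xy.1 ∧ (1 + δt ^ 2)⁻¹ < normSq3 xy.1}, ∫⁻ z : Fin 3 → ℝ, ENNReal.ofReal (gnomonicWeight xy.1 * gnomonicWeight xy.2 * gnomonicWeight z) *
              ∫⁻ F : Fol L → Fin 3 → ℝ,
                ENNReal.ofReal (Real.exp (-(b * gnoDeficit (fun _ => false) (fun _ => 1) (hubAt δt 1) ε ((xy, (z, F)) : GnoCoord L))) * piWeight F) ≤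
            ENNReal.ofReal (Φ * (L : ℝ) ^ cΦ * (2 * Real.pi / b) ^ ((7 : ℝ) / 2) *
                (2 * Real.pi / ((1 - 1 / (2 * (finrank ℝ (GnoFol L) : ℝ))) * b)) ^ ((finrank ℝ (GnoFol L) : ℝ) / 2)) *
              (∫⁻ p : ℝ × ℝ, ENNReal.ofReal ((1 + δt ^ 2) ^ 2 / (1 + (p.1 ^ 2 / (1 + p.1 ^ 2) + p.2 ^ 2 / (1 + p.2 ^ 2)) * (1 + δt ^ 2)) *
                ((1 + p.1 ^ 2)⁻¹ * (1 + p.2 ^ 2)⁻¹ / Real.sqrt (LinearMap.det (A0 (gnoBase p.1 p.2)))))) +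
            ENNReal.ofReal (Real.exp (CT * (L : ℝ) ^ pT - b / (QT * (L : ℝ) ^ pT)))))
    (hY : (∃ Φ : ℝ, 0 < Φ ∧ ∃ cΦ : ℕ, ∃ CT : ℝ, ∃ pT : ℕ, ∃ QT : ℝ, 0 < QT ∧ ∃ K₁ : ℝ, 0 < K₁ ∧ ∃ k₁ : ℕ, ∃ DR : ℝ, 1 ≤ DR ∧ ∃ dR : ℕ,
      ∀ (L : ℕ) [NeZero L] (b : ℝ), K₁ * (L : ℝ) ^ k₁ ≤ b → ∀ ε : GnoSign L, GoodSign ε → ∀ δt : ℝ, DR * (L : ℝ) ^ dR ≤ δt →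
        ∀ (A0 : GnoCoord L → GnoFol L →ₗ[ℝ] GnoFol L), (∀ η, (A0 η).IsSymmetric) →
          (∀ η (y : GnoFol L), ⟪A0 η y, y⟫_ℝ = iteratedFDeriv ℝ 2 (fun y' : GnoFol L => gnoDeficit z₀ (fun _ => 1) ((1 : ℝ) : ℍ) ε (η + gnoFolEmb y')) 0 (fun _ => y)) →
          (∀ η (y : GnoFol L), ⟪A0 η y, y⟫_ℝ = iteratedDeriv 2 (fun s : ℝ => gnoDeficit (fun _ => false) (fun _ => 1) ((1 : ℝ) : ℍ) ε (η + s • gnoFolEmb y)) 0) →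
          (∀ η (y : GnoFol L), ⟪A0 η y, y⟫_ℝ = iteratedFDeriv ℝ 2 (gnoDeficit z₀ (fun _ => 1) ((1 : ℝ) : ℍ) ε) η (fun _ => gnoFolEmb y)) →
          (Measurable fun q : GnoCoord L × GnoFol L => ⟪A0 q.1 q.2, q.2⟫_ℝ) →
          ∫⁻ xy in {xy : (Fin 3 → ℝ) × (Fin 3 → ℝ) | normSq3 xy.1 < normSq3 xy.2 ∧ (1 + δt ^ 2)⁻¹ < normSq3 xy.2}, ∫⁻ z : Fin 3 → ℝ, ENNReal.ofReal (gnomonicWeight xy.1 * gnomonicWeight xy.2 * gnomonicWeight z) *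
              ∫⁻ F : Fol L → Fin 3 → ℝ,
                ENNReal.ofReal (Real.exp (-(b * gnoDeficit (fun _ => false) (fun _ => 1) (hubAt δt 1) ε ((xy, (z, F)) : GnoCoord L))) * piWeight F) ≤
            ENNReal.ofReal (Φ * (L : ℝ) ^ cΦ * (2 * Real.pi / b) ^ ((7 : ℝ) / 2) *
                (2 * Real.pi / ((1 - 1 / (2 * (finrank ℝ (GnoFol L) : ℝ))) * b)) ^ ((finrank ℝ (GnoFol L) : ℝ) / 2)) *
              (∫⁻ p : ℝ × ℝ, ENNReal.ofReal ((1 + δt ^ 2) ^ 2 / (1 + (p.1 ^ 2 / (1 + p.1 ^ 2) + p.2 ^ 2 / (1 + p.2 ^ 2)) * (1 + δt ^ 2)) *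
                ((1 + p.1 ^ 2)⁻¹ * (1 + p.2 ^ 2)⁻¹ / Real.sqrt (LinearMap.det (A0 (gnoBase p.1 p.2)))))) +
            ENNReal.ofReal (Real.exp (CT * (L : ℝ) ^ pT - b / (QT * (L : ℝ) ^ pT))))) :
    (∃ Φ : ℝ, 0 < Φ ∧ ∃ cΦ : ℕ, ∃ CT : ℝ, ∃ pT : ℕ, ∃ QT : ℝ, 0 < QT ∧ ∃ K₁ : ℝ, 0 < K₁ ∧ ∃ k₁ : ℕ, ∃ DR : ℝ, 1 ≤ DR ∧ ∃ dR : ℕ,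
      ∀ (L : ℕ) [NeZero L] (b : ℝ), K₁ * (L : ℝ) ^ k₁ ≤ b → ∀ ε : GnoSign L, GoodSign ε → ∀ δt : ℝ, DR * (L : ℝ) ^ dR ≤ δt →
        ∀ (A0 : GnoCoord L → GnoFol L →ₗ[ℝ] GnoFol L), (∀ η, (A0 η).IsSymmetric) →
          (∀ η (y : GnoFol L), ⟪A0 η y, y⟫_ℝ = iteratedFDeriv ℝ 2 (fun y' : GnoFol L => gnoDeficit z₀ (fun _ => 1) ((1 : ℝ) : ℍ) ε (η + gnoFolEmb y')) 0 (fun _ => y)) →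
          (∀ η (y : GnoFol L), ⟪A0 η y, y⟫_ℝ = iteratedDeriv 2 (fun s : ℝ => gnoDeficit (fun _ => false) (fun _ => 1) ((1 : ℝ) : ℍ) ε (η + s • gnoFolEmb y)) 0) →
          (∀ η (y : GnoFol L), ⟪A0 η y, y⟫_ℝ = iteratedFDeriv ℝ 2 (gnoDeficit z₀ (fun _ => 1) ((1 : ℝ) : ℍ) ε) η (fun _ => gnoFolEmb y)) →
          (Measurable fun q : GnoCoord L × GnoFol L => ⟪A0 q.1 q.2, q.2⟫_ℝ) →
          ∫⁻ xy : (Fin 3 → ℝ) × (Fin 3 → ℝ), ∫⁻ z : Fin 3 → ℝ, ENNReal.ofReal (gnomonicWeight xy.1 * gnomonicWeight xy.2 * gnomonicWeight z) *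
              ∫⁻ F : Fol L → Fin 3 → ℝ,
                ENNReal.ofReal (Real.exp (-(b * gnoDeficit (fun _ => false) (fun _ => 1) (hubAt δt 1) ε ((xy, (z, F)) : GnoCoord L))) * piWeight F) ≤
            ENNReal.ofReal (Φ * (L : ℝ) ^ cΦ * (2 * Real.pi / b) ^ ((7 : ℝ) / 2) *
                (2 * Real.pi / ((1 - 1 / (2 * (finrank ℝ (GnoFol L) : ℝ))) * b)) ^ ((finrank ℝ (GnoFol L) : ℝ) / 2)) *
              (∫⁻ p : ℝ × ℝ, ENNReal.ofReal ((1 + δt ^ 2) ^ 2 / (1 + (p.1 ^ 2 / (1 + p.1 ^ 2) + p.2 ^ 2 / (1 + p.2 ^ 2)) * (1 + δt ^ 2)) *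
                ((1 + p.1 ^ 2)⁻¹ * (1 + p.2 ^ 2)⁻¹ / Real.sqrt (LinearMap.det (A0 (gnoBase p.1 p.2)))))) +
            ENNReal.ofReal (Real.exp (CT * (L : ℝ) ^ pT - b / (QT * (L : ℝ) ^ pT)))) :=
  leaderLayer_aligned
    (fun _ δt => {xy : (Fin 3 → ℝ) × (Fin 3 → ℝ) | normSq3 xy.1 ≤ (1 + δt ^ 2)⁻¹ ∧ normSq3 xy.2 ≤ (1 + δt ^ 2)⁻¹})
    (fun _ δt => {xy : (Fin 3 → ℝ) × (Fin 3 → ℝ) | normSq3 xy.2 ≤ normSq3 xy.1 ∧ (1 + δt ^ 2)⁻¹ < normSq3 xy.1})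
    (fun _ δt => {xy : (Fin 3 → ℝ) × (Fin 3 → ℝ) | normSq3 xy.1 < normSq3 xy.2 ∧ (1 + δt ^ 2)⁻¹ < normSq3 xy.2})
    (fun _ δt xy => leaderRegions_cover δt xy) leaderLayer_ORIG hX hY

/-- ★★★ **(hCore) FROM THE TWO REMAINING REGION SOCKETS**: `regionSocket PX → regionSocket PY → <frozen (hCore) binder VERBATIM>`. [cite: Luscher1983, §2] -/
theorem hubIntegral_hubAt_core_ceiling_of_PX_PY
    (hX : (∃ Φ : ℝ, 0 < Φ ∧ ∃ cΦ : ℕ, ∃ CT : ℝ, ∃ pT : ℕ, ∃ QT : ℝ, 0 < QT ∧ ∃ K₁ : ℝ, 0 < K₁ ∧ ∃ k₁ : ℕ, ∃ DR : ℝ, 1 ≤ DR ∧ ∃ dR : ℕ,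
      ∀ (L : ℕ) [NeZero L] (b : ℝ), K₁ * (L : ℝ) ^ k₁ ≤ b → ∀ ε : GnoSign L, GoodSign ε → ∀ δt : ℝ, DR * (L : ℝ) ^ dR ≤ δt →
        ∀ (A0 : GnoCoord L → GnoFol L →ₗ[ℝ] GnoFol L), (∀ η, (A0 η).IsSymmetric) →
          (∀ η (y : GnoFol L), ⟪A0 η y, y⟫_ℝ = iteratedFDeriv ℝ 2 (fun y' : GnoFol L => gnoDeficit z₀ (fun _ => 1) ((1 : ℝ) : ℍ) ε (η + gnoFolEmb y')) 0 (fun _ => y)) →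
          (∀ η (y : GnoFol L), ⟪A0 η y, y⟫_ℝ = iteratedDeriv 2 (fun s : ℝ => gnoDeficit (fun _ => false) (fun _ => 1) ((1 : ℝ) : ℍ) ε (η + s • gnoFolEmb y)) 0) →
          (∀ η (y : GnoFol L), ⟪A0 η y, y⟫_ℝ = iteratedFDeriv ℝ 2 (gnoDeficit z₀ (fun _ => 1) ((1 : ℝ) : ℍ) ε) η (fun _ => gnoFolEmb y)) →
          (Measurable fun q : GnoCoord L × GnoFol L => ⟪A0 q.1 q.2, q.2⟫_ℝ) →
          ∫⁻ xy in {xy : (Fin 3 → ℝ) × (Fin 3 → ℝ) | normSq3 xy.2 ≤ normSq3 xy.1 ∧ (1 + δt ^ 2)⁻¹ < normSq3 xy.1}, ∫⁻ z : Fin 3 → ℝ, ENNReal.ofReal (gnomonicWeight xy.1 * gnomonicWeight xy.2 * gnomonicWeight z) *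
              ∫⁻ F : Fol L → Fin 3 → ℝ,
                ENNReal.ofReal (Real.exp (-(b * gnoDeficit (fun _ => false) (fun _ => 1) (hubAt δt 1) ε ((xy, (z, F)) : GnoCoord L))) * piWeight F) ≤
            ENNReal.ofReal (Φ * (L : ℝ) ^ cΦ * (2 * Real.pi / b) ^ ((7 : ℝ) / 2) *
                (2 * Real.pi / ((1 - 1 / (2 * (finrank ℝ (GnoFol L) : ℝ))) * b)) ^ ((finrank ℝ (GnoFol L) : ℝ) / 2)) *
              (∫⁻ p : ℝ × ℝ, ENNReal.ofReal ((1 + δt ^ 2) ^ 2 / (1 + (p.1 ^ 2 / (1 + p.1 ^ 2) + p.2 ^ 2 / (1 + p.2 ^ 2)) * (1 + δt ^ 2)) *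
                ((1 + p.1 ^ 2)⁻¹ * (1 + p.2 ^ 2)⁻¹ / Real.sqrt (LinearMap.det (A0 (gnoBase p.1 p.2)))))) +
            ENNReal.ofReal (Real.exp (CT * (L : ℝ) ^ pT - b / (QT * (L : ℝ) ^ pT)))))
    (hY : (∃ Φ : ℝ, 0 < Φ ∧ ∃ cΦ : ℕ, ∃ CT : ℝ, ∃ pT : ℕ, ∃ QT : ℝ, 0 < QT ∧ ∃ K₁ : ℝ, 0 < K₁ ∧ ∃ k₁ : ℕ, ∃ DR : ℝ, 1 ≤ DR ∧ ∃ dR : ℕ,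
      ∀ (L : ℕ) [NeZero L] (b : ℝ), K₁ * (L : ℝ) ^ k₁ ≤ b → ∀ ε : GnoSign L, GoodSign ε → ∀ δt : ℝ, DR * (L : ℝ) ^ dR ≤ δt →
        ∀ (A0 : GnoCoord L → GnoFol L →ₗ[ℝ] GnoFol L), (∀ η, (A0 η).IsSymmetric) →
          (∀ η (y : GnoFol L), ⟪A0 η y, y⟫_ℝ = iteratedFDeriv ℝ 2 (fun y' : GnoFol L => gnoDeficit z₀ (fun _ => 1) ((1 : ℝ) : ℍ) ε (η + gnoFolEmb y')) 0 (fun _ => y)) →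
          (∀ η (y : GnoFol L), ⟪A0 η y, y⟫_ℝ = iteratedDeriv 2 (fun s : ℝ => gnoDeficit (fun _ => false) (fun _ => 1) ((1 : ℝ) : ℍ) ε (η + s • gnoFolEmb y)) 0) →
          (∀ η (y : GnoFol L), ⟪A0 η y, y⟫_ℝ = iteratedFDeriv ℝ 2 (gnoDeficit z₀ (fun _ => 1) ((1 : ℝ) : ℍ) ε) η (fun _ => gnoFolEmb y)) →
          (Measurable fun q : GnoCoord L × GnoFol L => ⟪A0 q.1 q.2, q.2⟫_ℝ) →
          ∫⁻ xy in {xy : (Fin 3 → ℝ) × (Fin 3 → ℝ) | normSq3 xy.1 < normSq3 xy.2 ∧ (1 + δt ^ 2)⁻¹ < normSq3 xy.2}, ∫⁻ z : Fin 3 → ℝ, ENNReal.ofReal (gnomonicWeight xy.1 * gnomonicWeight xy.2 * gnomonicWeight z) *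
              ∫⁻ F : Fol L → Fin 3 → ℝ,
                ENNReal.ofReal (Real.exp (-(b * gnoDeficit (fun _ => false) (fun _ => 1) (hubAt δt 1) ε ((xy, (z, F)) : GnoCoord L))) * piWeight F) ≤
            ENNReal.ofReal (Φ * (L : ℝ) ^ cΦ * (2 * Real.pi / b) ^ ((7 : ℝ) / 2) *
                (2 * Real.pi / ((1 - 1 / (2 * (finrank ℝ (GnoFol L) : ℝ))) * b)) ^ ((finrank ℝ (GnoFol L) : ℝ) / 2)) *
              (∫⁻ p : ℝ × ℝ, ENNReal.ofReal ((1 + δt ^ 2) ^ 2 / (1 + (p.1 ^ 2 / (1 + p.1 ^ 2) + p.2 ^ 2 / (1 + p.2 ^ 2)) * (1 + δt ^ 2)) *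
                ((1 + p.1 ^ 2)⁻¹ * (1 + p.2 ^ 2)⁻¹ / Real.sqrt (LinearMap.det (A0 (gnoBase p.1 p.2)))))) +
            ENNReal.ofReal (Real.exp (CT * (L : ℝ) ^ pT - b / (QT * (L : ℝ) ^ pT))))) :
    ∃ Φ : ℝ, 0 < Φ ∧ ∃ cΦ : ℕ, ∃ CT : ℝ, ∃ pT : ℕ, ∃ QT : ℝ, 0 < QT ∧ ∃ K₁ : ℝ, 0 < K₁ ∧ ∃ k₁ : ℕ, ∃ DR : ℝ, 1 ≤ DR ∧ ∃ dR : ℕ,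
      ∀ (L : ℕ) [NeZero L] (b : ℝ), K₁ * (L : ℝ) ^ k₁ ≤ b → ∀ ε : GnoSign L, GoodSign ε → ∀ δs δt : ℝ, DR * (L : ℝ) ^ dR ≤ δs → δs ≤ δt →
        hubIntegral (hubAt δt 1) ε b ≤ Φ * (L : ℝ) ^ cΦ * ((2 * Real.pi / b) ^ alpha L *
            ∫ p : ℝ × ℝ, ((1 + δt ^ 2) ^ 2 / (1 + (p.1 ^ 2 / (1 + p.1 ^ 2) + p.2 ^ 2 / (1 + p.2 ^ 2)) * (1 + δt ^ 2))) * mbDensity (hubAt δs 1) ε p) +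
          Real.exp (CT * (L : ℝ) ^ pT - b / (QT * (L : ℝ) ^ pT)) :=
  hubIntegral_hubAt_core_ceiling_of_leaderLayer_meas (tip_leaderLayer hX hY)

end Summit.QuantumFields.YangMills.Theorems.SwapVirialDeficit.SectorLaplace

end
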